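import Literature.Probability.LatticeModels.PercolationPolygonWord
import HarnessLib

/-!
# The word of a lattice polygon, I: level graphs and the one-row stages

First of four files proving the named fact
`Literature.Probability.LatticeModels.RowTransferExactness` (`PercolationPolygonWord.lean`;
support item `RowTransferExactness` of route `CriticalPhenomena/CardyPolygonWords`): at an aligned
mesh the G02 crossing probability of a lattice polygon under bond percolation on `ℤ²` at `p = 1/2`
IS the amplitude of its transfer-matrix word. This file is the deterministic connectivity
bookkeeping behind one row of the word (Cardy, arXiv:math-ph/0103018, §7.1; Bondesan–Jacobsen–
Saleur, arXiv:1207.7005, §5; Jacobsen–Zinn-Justin, arXiv:cond-mat/0111374, §4 — the row transfer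
matrix acts on the partition of the current row into classes "joined below the row"); the precise
statements are folklore with no single printed source.

* Bonds of `ℤ²` are labelled by `Site 2 × Fin 2`: `(v, 0)` is the vertical bond below `v`
  (joining `v - e₁` to `v`), `(v, 1)` the horizontal bond to the right of `v` (joining `v` to
  `v + e₀`). A bond configuration is read through a set `D` of open labels.
* `openInduced D V`: the open subgraph of `ℤ²` induced on the finite vertex set `V`.
* `levelGraph D V W y` on `Node = Site 2 ⊕ Fin 2`: the open bonds of `V` within the rows `≤ y`
  together with an edge from every vertex of `V ∩ W i` of row `≤ y` to the star `⋆ i` (the two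
  stars are hubs standing for the two discrete arcs met so far).
* `Represents ρ G emb`: the setoid `ρ` on row points is the connectivity of `G` pulled back along
  the embedding `emb` (`rowEmb S y`: column `x ↦ (x, y)`, star `↦` star).
* Generic lemmas: the extension lemma `represents_sup` (adding edges between embedded points =
  joining the setoid with the corresponding pairs), the projection lemma `reachable_iff_of_proj`
  (pendant edges), isolated vertices, closed sets.
* The four stages `stage1 ≤ … ≤ stage4` interpolating between the level graphs of rows `y - 1` and
  `y` (new vertical bonds, new horizontal bonds, new star edges) and the comparison
  `levelGraph_le_stage4`, `stage4_le_levelGraph`.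

The step lemmas, the invariant of the deterministic word, the counting identity and the Bernoulli
marginal are in the sequels `PolygonWordRowSteps`, `PolygonWordCounting`, `PolygonWordExactness`.
-/

noncomputable section

open Finset SimpleGraph
open scoped Classical

namespace Literature.Probability.LatticeModels

namespace PolygonWord

/-! ### Generic lemmas: setoids generated by edges versus reachability -/

section Generic

variable {α β : Type*}

/-- Reachability pulled back along a map of vertices, as a setoid. [folklore] -/
def reachSetoid (G : SimpleGraph α) (emb : β → α) : Setoid β :=
  Setoid.comap emb G.reachableSetoid

/-- Unfolding `reachSetoid`. [folklore] -/
theorem reachSetoid_rel (G : SimpleGraph α) (emb : β → α) (a c : β) :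
    reachSetoid G emb a c ↔ G.Reachable (emb a) (emb c) :=
  Setoid.comap_rel _ _ _ _

/-- A setoid `ρ` **represents** the graph `G` along `emb`: `ρ a c` iff `emb a`, `emb c` are
joined in `G`. [folklore] -/
def Represents (ρ : Setoid β) (G : SimpleGraph α) (emb : β → α) : Prop :=
  ∀ a c, ρ a c ↔ G.Reachable (emb a) (emb c)

/-- `Represents ρ G emb` says `ρ = reachSetoid G emb`. [folklore] -/
theorem represents_iff_eq (ρ : Setoid β) (G : SimpleGraph α) (emb : β → α) :
    Represents ρ G emb ↔ ρ = reachSetoid G emb := by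
  constructor
  · intro h
    ext a c
    rw [h a c, reachSetoid_rel]
  · rintro rfl a c
    exact reachSetoid_rel G emb a c

/-- The reflexive–transitive closure of reachability is reachability. [folklore] -/
theorem reachable_of_reflTransGen {G : SimpleGraph α} {u v : α}
    (h : Relation.ReflTransGen G.Reachable u v) : G.Reachable u v := by
  induction h with
  | refl => exact Reachable.refl _
  | tail _ hbc ih => exact ih.trans hbc

/-- **Extension lemma (hard direction).** Let `G ≤ G'`, let `ρ ≤ θ` be setoids on `β` such that
`G`-reachability of embedded points implies `ρ`, and suppose every edge of `G'` is an edge of `G`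
or joins two embedded points related by `θ`. Then `G'`-reachability of embedded points implies
`θ`. [folklore] -/
theorem rel_of_reachable_sup {G G' : SimpleGraph α} (emb : β → α) {ρ θ : Setoid β}
    (hρθ : ρ ≤ θ) (hρ : ∀ a c, G.Reachable (emb a) (emb c) → ρ a c)
    (hnew : ∀ u v, G'.Adj u v → G.Adj u v ∨ ∃ a c, emb a = u ∧ emb c = v ∧ θ a c)
    {a c : β} (h : G'.Reachable (emb a) (emb c)) : θ a c := by
  rw [reachable_iff_reflTransGen] at h
  -- invariant along the walk: from `u` one reaches in `G` an embedded point `θ`-related to `c`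
  suffices key : ∀ u, Relation.ReflTransGen G'.Adj u (emb c) →
      ∃ c', G.Reachable u (emb c') ∧ θ c' c by
    obtain ⟨c', h1, h2⟩ := key _ h
    exact Setoid.trans' θ (hρθ (hρ a c' h1)) h2
  intro u hu
  induction hu using Relation.ReflTransGen.head_induction_on with
  | refl => exact ⟨c, Reachable.refl _, Setoid.refl' θ c⟩
  | head huw _ ih =>
    obtain ⟨c', hw, hθ⟩ := ih
    rcases hnew _ _ huw with hG | ⟨a₁, a₂, rfl, rfl, h12⟩
    · exact ⟨c', (Adj.reachable hG).trans hw, hθ⟩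
    · exact ⟨a₁, Reachable.refl _,
        Setoid.trans' θ h12 (Setoid.trans' θ (hρθ (hρ a₂ c' hw)) hθ)⟩

/-- **Extension lemma.** If `ρ` represents `G`, `G ≤ G'`, `ρ ≤ θ ≤ reachSetoid G' emb`, and every
new edge of `G'` joins two embedded `θ`-related points, then `θ` represents `G'`. [folklore] -/
theorem represents_sup {G G' : SimpleGraph α} (emb : β → α) {ρ θ : Setoid β}
    (hρ : Represents ρ G emb) (hρθ : ρ ≤ θ) (hθ : θ ≤ reachSetoid G' emb)
    (hnew : ∀ u v, G'.Adj u v → G.Adj u v ∨ ∃ a c, emb a = u ∧ emb c = v ∧ θ a c) :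
    Represents θ G' emb := by
  intro a c
  constructor
  · intro h
    exact (reachSetoid_rel G' emb a c).1 (hθ h)
  · exact rel_of_reachable_sup emb hρθ (fun a c h => (hρ a c).2 h) hnew

/-- A represented setoid is below the pulled-back reachability of any larger graph. [folklore] -/
theorem le_reachSetoid_of_represents {G G' : SimpleGraph α} (emb : β → α) {ρ : Setoid β}
    (hρ : Represents ρ G emb) (hGG' : G ≤ G') : ρ ≤ reachSetoid G' emb := by
  intro a c h
  exact (reachSetoid_rel G' emb a c).2 (((hρ a c).1 h).mono hGG')

/-- **Projection lemma.** If `φ` moves every vertex to a `G'`-neighbour-or-itself and every edge of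
`G'` is mapped by `φ` to an edge of `G ≤ G'` or collapsed, then `G'`-reachability is
`G`-reachability of the projections. Used for the vertical layer, where `φ` slides each new site
down its open vertical bond. [folklore] -/
theorem reachable_iff_of_proj {G G' : SimpleGraph α} (hGG' : G ≤ G') (φ : α → α)
    (hφ : ∀ u, G'.Reachable u (φ u))
    (hedge : ∀ u v, G'.Adj u v → φ u = φ v ∨ G.Adj (φ u) (φ v)) (u v : α) :
    G'.Reachable u v ↔ G.Reachable (φ u) (φ v) := by
  constructor
  · intro h
    rw [reachable_iff_reflTransGen] at h
    refine reachable_of_reflTransGen (Relation.ReflTransGen.lift φ (fun a b hab => ?_) _ _ h)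
    show G.Reachable (φ a) (φ b)
    rcases hedge a b hab with h | h
    · rw [h]
    · exact h.reachable
  · intro h
    exact ((hφ u).trans (h.mono hGG')).trans (hφ v).symm

/-- An isolated vertex reaches only itself. [folklore] -/
theorem reachable_iff_eq_of_isolated {G : SimpleGraph α} {u : α} (hu : ∀ w, ¬ G.Adj u w) (v : α) :
    G.Reachable u v ↔ u = v := by
  constructor
  · intro h
    rw [reachable_iff_reflTransGen] at h
    rcases h.cases_head with h | ⟨w, huw, _⟩
    · exact h
    · exact absurd huw (hu w)
  · rintro rfl
    exact Reachable.refl _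

/-- Membership of the endpoint of a walk in a set closed under adjacency. [folklore] -/
theorem mem_of_reachable_of_closed {G : SimpleGraph α} {C : Set α}
    (hC : ∀ u v, u ∈ C → G.Adj u v → v ∈ C) {u v : α} (hu : u ∈ C) (h : G.Reachable u v) :
    v ∈ C := by
  rw [reachable_iff_reflTransGen] at h
  induction h with
  | refl => exact hu
  | tail _ hbc ih => exact hC _ _ ih hbc

end Generic

/-! ### Setoid lemmas for the row letters -/

section SetoidLemmas

variable {S : Finset ℤ}

/-- `joinTwo₂ a b ≤ ρ` iff `ρ` joins `a` and `b`. [folklore] -/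
theorem joinTwo₂_le_iff (a b : RowPoint₂ S) (ρ : Setoid (RowPoint₂ S)) : joinTwo₂ a b ≤ ρ ↔ ρ a b := by
  constructor
  · intro h
    exact h (joinTwo₂_rel a b)
  · intro hab x y hxy
    change (if x = b then a else x) = (if y = b then a else y) at hxy
    by_cases hx : x = b <;> by_cases hy : y = b
    · rw [hx, hy]
    · rw [if_pos hx, if_neg hy] at hxy
      rw [hx, ← hxy]
      exact Setoid.symm' ρ hab
    · rw [if_neg hx, if_pos hy] at hxy
      rw [hxy, hy]
      exact hab
    · rw [if_neg hx, if_neg hy] at hxy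
      rw [hxy]

/-- The horizontal layer joins the two ends of every opened edge. [folklore] -/
theorem horizRel₂_rel_of_mem (H : Finset S) (π : Setoid (RowPoint₂ S)) {x : S} (hx : x ∈ H)
    (h1 : (x : ℤ) + 1 ∈ S) : horizRel₂ H π (Sum.inl x) (Sum.inl ⟨(x : ℤ) + 1, h1⟩) := by
  have hle : hEdgeRel₂ x ≤ horizRel₂ H π := (Finset.le_sup hx).trans le_sup_right
  refine hle ?_
  unfold hEdgeRel₂
  rw [dif_pos h1]
  exact joinTwo₂_rel _ _

/-- `horizRel₂ H π ≤ θ` once `π ≤ θ` and `θ` joins the ends of the opened edges. [folklore] -/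
theorem horizRel₂_le {H : Finset S} {π θ : Setoid (RowPoint₂ S)} (hπ : π ≤ θ)
    (hH : ∀ x ∈ H, ∀ h1 : (x : ℤ) + 1 ∈ S, θ (Sum.inl x) (Sum.inl ⟨(x : ℤ) + 1, h1⟩)) :
    horizRel₂ H π ≤ θ := by
  refine sup_le hπ (Finset.sup_le fun x hx => ?_)
  unfold hEdgeRel₂
  split_ifs with h1
  · exact (joinTwo₂_le_iff _ _ _).2 (hH x hx h1)
  · exact bot_le

/-- `wireRel A i π ≤ θ` once `π ≤ θ` and `θ` joins every column of `A` to `⋆ i`. [folklore] -/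
theorem wireRel_le {A : Finset S} {i : Fin 2} {π θ : Setoid (RowPoint₂ S)} (hπ : π ≤ θ)
    (hA : ∀ a ∈ A, θ (Sum.inl a) (RowPoint₂.star S i)) : wireRel A i π ≤ θ :=
  sup_le hπ (Finset.sup_le fun a ha => (joinTwo₂_le_iff _ _ _).2 (hA a ha))

end SetoidLemmas

/-! ### Nodes, bond labels and the level graph -/

/-- The nodes of the level graphs: lattice sites and the two stars. [folklore] -/
abbrev Node : Type := Site 2 ⊕ Fin 2

/-- The unit vector `eᵢ` of `ℤ²`. [folklore] -/
abbrev unitVec (i : Fin 2) : Site 2 := Pi.single i 1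

section Level

variable (D : Set (Site 2 × Fin 2)) (V : Finset (Site 2)) (W : Fin 2 → Set (Site 2))

/-- Oriented open bonds inside `V`: `v = u + e₁` with the vertical bond below `v` open, or
`v = u + e₀` with the horizontal bond right of `u` open. [folklore] -/
def inRel (u v : Site 2) : Prop :=
  u ∈ V ∧ v ∈ V ∧ ((v = u + unitVec 1 ∧ (v, (0 : Fin 2)) ∈ D) ∨ (v = u + unitVec 0 ∧ (u, (1 : Fin 2)) ∈ D))

/-- The open subgraph of `ℤ²` induced on `V` (bonds read from the label set `D`). [folklore] -/
def openInduced : SimpleGraph (Site 2) := SimpleGraph.fromRel (inRel D V)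

/-- The edge relation of the level graph at row `y`. [folklore] -/
def levelRel (y : ℤ) : Node → Node → Prop
  | Sum.inl u, Sum.inl v => inRel D V u v ∧ u 1 ≤ y ∧ v 1 ≤ y
  | Sum.inl u, Sum.inr i => u ∈ V ∧ u 1 ≤ y ∧ u ∈ W i
  | Sum.inr _, _ => False

/-- **The level graph** at row `y`: open bonds of `V` within rows `≤ y`, and the vertices of
`V ∩ W i` in rows `≤ y` wired to the star `⋆ i`. [folklore] -/
def levelGraph (y : ℤ) : SimpleGraph Node := SimpleGraph.fromRel (levelRel D V W y)

/-- New vertical bonds when passing to row `y`. [folklore] -/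
def vertNew (y : ℤ) : Node → Node → Prop
  | Sum.inl u, Sum.inl v => u ∈ V ∧ v ∈ V ∧ v = u + unitVec 1 ∧ (v, (0 : Fin 2)) ∈ D ∧ v 1 = y
  | _, _ => False

/-- New horizontal bonds of row `y`. [folklore] -/
def horizNew (y : ℤ) : Node → Node → Prop
  | Sum.inl u, Sum.inl v => u ∈ V ∧ v ∈ V ∧ v = u + unitVec 0 ∧ (u, (1 : Fin 2)) ∈ D ∧ u 1 = y
  | _, _ => False

/-- New star edges of row `y` towards `⋆ i`. [folklore] -/
def starNew (y : ℤ) (i : Fin 2) : Node → Node → Prop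
  | Sum.inl u, Sum.inr j => j = i ∧ u ∈ V ∧ u 1 = y ∧ u ∈ W i
  | _, _ => False

/-- Stage 1 of row `y`: the previous level graph plus the new vertical bonds. [folklore] -/
def stage1 (y : ℤ) : SimpleGraph Node := levelGraph D V W (y - 1) ⊔ SimpleGraph.fromRel (vertNew D V y)

/-- Stage 2: plus the horizontal bonds of row `y`. [folklore] -/
def stage2 (y : ℤ) : SimpleGraph Node := stage1 D V W y ⊔ SimpleGraph.fromRel (horizNew D V y)

/-- Stage 3: plus the star edges of row `y` towards `⋆ 0`. [folklore] -/
def stage3 (y : ℤ) : SimpleGraph Node := stage2 D V W y ⊔ SimpleGraph.fromRel (starNew V W y 0)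

/-- Stage 4: plus the star edges of row `y` towards `⋆ 1`. [folklore] -/
def stage4 (y : ℤ) : SimpleGraph Node := stage3 D V W y ⊔ SimpleGraph.fromRel (starNew V W y 1)

/-- The embedding of the row points over the columns `S` at height `y` into the nodes.
[folklore] -/
def rowEmb (S : Finset ℤ) (y : ℤ) : RowPoint₂ S → Node
  | Sum.inl x => Sum.inl ![(x : ℤ), y]
  | Sum.inr i => Sum.inr i

end Level

/-! ### Coordinates -/

section Coord

/-- Equality of sites in coordinates. [folklore] -/
theorem vec_eq_vec_iff (x y x' y' : ℤ) : ((![x, y] : Site 2) = ![x', y']) ↔ x = x' ∧ y = y' := by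
  simp [funext_iff, Fin.forall_fin_two]

/-- `(x, y) + e₀ = (x + 1, y)`. [folklore] -/
theorem vec_add_unitVec_zero (x y : ℤ) : (![x, y] : Site 2) + unitVec 0 = ![x + 1, y] := by
  ext i; fin_cases i <;> simp

/-- `(x, y) + e₁ = (x, y + 1)`. [folklore] -/
theorem vec_add_unitVec_one (x y : ℤ) : (![x, y] : Site 2) + unitVec 1 = ![x, y + 1] := by
  ext i; fin_cases i <;> simp

/-- `(x, y) - e₁ = (x, y - 1)`. [folklore] -/
theorem vec_sub_unitVec_one (x y : ℤ) : (![x, y] : Site 2) - unitVec 1 = ![x, y - 1] := by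
  ext i; fin_cases i <;> simp

/-- Rows of the two ends of a vertical bond. [folklore] -/
theorem add_unitVec_one_apply_one (u : Site 2) : (u + unitVec 1 : Site 2) 1 = u 1 + 1 := by simp

/-- Columns of the two ends of a vertical bond. [folklore] -/
theorem add_unitVec_one_apply_zero (u : Site 2) : (u + unitVec 1 : Site 2) 0 = u 0 := by simp

/-- Rows of the two ends of a horizontal bond. [folklore] -/
theorem add_unitVec_zero_apply_one (u : Site 2) : (u + unitVec 0 : Site 2) 1 = u 1 := by simp

/-- Columns of the two ends of a horizontal bond. [folklore] -/
theorem add_unitVec_zero_apply_zero (u : Site 2) : (u + unitVec 0 : Site 2) 0 = u 0 + 1 := by simp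

/-- The row embedding is injective. [folklore] -/
theorem rowEmb_injective (S : Finset ℤ) (y : ℤ) : Function.Injective (rowEmb S y) := by
  rintro (x | i) (x' | i') h
  · simp only [rowEmb, Sum.inl.injEq, vec_eq_vec_iff, and_true] at h
    exact congrArg Sum.inl (Subtype.ext h)
  · simp [rowEmb] at h
  · simp [rowEmb] at h
  · simp only [rowEmb, Sum.inr.injEq] at h
    rw [h]

end Coord

/-! ### The level graph at row `y` versus the four stages -/

section Stages

variable (D : Set (Site 2 × Fin 2)) (V : Finset (Site 2)) (W : Fin 2 → Set (Site 2))

/-- The level relation is monotone in the row. [folklore] -/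
theorem levelRel_mono {y y' : ℤ} (h : y ≤ y') {p q : Node} (hpq : levelRel D V W y p q) :
    levelRel D V W y' p q := by
  rcases p with u | i <;> rcases q with v | j
  · exact ⟨hpq.1, hpq.2.1.trans h, hpq.2.2.trans h⟩
  · exact ⟨hpq.1, hpq.2.1.trans h, hpq.2.2⟩
  · exact hpq.elim
  · exact hpq.elim

/-- The chain of stages. [folklore] -/
theorem levelGraph_pred_le_stage1 (y : ℤ) : levelGraph D V W (y - 1) ≤ stage1 D V W y :=
  le_sup_left

/-- The chain of stages. [folklore] -/
theorem stage1_le_stage2 (y : ℤ) : stage1 D V W y ≤ stage2 D V W y := le_sup_left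

/-- The chain of stages. [folklore] -/
theorem stage2_le_stage3 (y : ℤ) : stage2 D V W y ≤ stage3 D V W y := le_sup_left

/-- The chain of stages. [folklore] -/
theorem stage3_le_stage4 (y : ℤ) : stage3 D V W y ≤ stage4 D V W y := le_sup_left

/-- From an oriented relation to the adjacency of `fromRel`. [folklore] -/
theorem fromRel_adj_of_rel {α : Type*} {r : α → α → Prop} {p q : α} (hne : p ≠ q) (h : r p q) :
    (SimpleGraph.fromRel r).Adj p q :=
  (SimpleGraph.fromRel_adj r p q).2 ⟨hne, Or.inl h⟩

/-- One direction of the comparison: every edge of the level graph at row `y` is an edge of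
stage 4. [folklore] -/
theorem levelGraph_le_stage4 (y : ℤ) : levelGraph D V W y ≤ stage4 D V W y := by
  -- it suffices to treat the oriented relation
  suffices key : ∀ p q, p ≠ q → levelRel D V W y p q → (stage4 D V W y).Adj p q by
    intro p q h
    obtain ⟨hne, h | h⟩ := (SimpleGraph.fromRel_adj _ p q).1 h
    · exact key p q hne h
    · exact (key q p hne.symm h).symm
  have h01 : levelGraph D V W (y - 1) ≤ stage4 D V W y :=
    (levelGraph_pred_le_stage1 D V W y).trans
      ((stage1_le_stage2 D V W y).trans ((stage2_le_stage3 D V W y).trans (stage3_le_stage4 D V W y)))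
  rintro (u | i) (v | j) hne h
  · obtain ⟨⟨hu, hv, hb⟩, huy, hvy⟩ := h
    rcases hb with ⟨rfl, hd⟩ | ⟨rfl, hd⟩
    · -- vertical bond `u — u + e₁`
      by_cases hrow : (u + unitVec 1 : Site 2) 1 ≤ y - 1
      · refine h01 (fromRel_adj_of_rel hne ?_)
        refine ⟨⟨hu, hv, Or.inl ⟨rfl, hd⟩⟩, ?_, hrow⟩
        rw [add_unitVec_one_apply_one] at hrow
        omega
      · have hy : (u + unitVec 1 : Site 2) 1 = y := by omega
        exact ((stage1_le_stage2 D V W y).trans ((stage2_le_stage3 D V W y).trans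
            (stage3_le_stage4 D V W y)))
          (le_sup_right (a := levelGraph D V W (y - 1))
            (fromRel_adj_of_rel hne (⟨hu, hv, rfl, hd, hy⟩ : vertNew D V y (Sum.inl u) (Sum.inl (u + unitVec 1)))))
    · -- horizontal bond `u — u + e₀`
      by_cases hrow : u 1 ≤ y - 1
      · refine h01 (fromRel_adj_of_rel hne ?_)
        refine ⟨⟨hu, hv, Or.inr ⟨rfl, hd⟩⟩, hrow, ?_⟩
        rw [add_unitVec_zero_apply_one]
        exact hrow
      · have hy : u 1 = y := by omega
        exact ((stage2_le_stage3 D V W y).trans (stage3_le_stage4 D V W y))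
          (le_sup_right (a := stage1 D V W y)
            (fromRel_adj_of_rel hne (⟨hu, hv, rfl, hd, hy⟩ : horizNew D V y (Sum.inl u) (Sum.inl (u + unitVec 0)))))
  · obtain ⟨hu, huy, hw⟩ := h
    by_cases hrow : u 1 ≤ y - 1
    · exact h01 (fromRel_adj_of_rel hne (⟨hu, hrow, hw⟩ : levelRel D V W (y - 1) (Sum.inl u) (Sum.inr j)))
    · have hy : u 1 = y := by omega
      fin_cases j
      · exact (stage3_le_stage4 D V W y)
          (le_sup_right (a := stage2 D V W y)
            (fromRel_adj_of_rel hne (⟨rfl, hu, hy, hw⟩ : starNew V W y 0 (Sum.inl u) (Sum.inr 0))))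
      · exact le_sup_right (a := stage3 D V W y)
          (fromRel_adj_of_rel hne (⟨rfl, hu, hy, hw⟩ : starNew V W y 1 (Sum.inl u) (Sum.inr 1)))
  · exact h.elim
  · exact h.elim

/-- The other direction: every edge of stage 4 is an edge of the level graph at row `y`.
[folklore] -/
theorem stage4_le_levelGraph (y : ℤ) : stage4 D V W y ≤ levelGraph D V W y := by
  -- each of the five pieces is below the level graph; oriented relations suffice
  have piece : ∀ r : Node → Node → Prop, (∀ p q, r p q → levelRel D V W y p q) →
      SimpleGraph.fromRel r ≤ levelGraph D V W y := by
    intro r hr p q h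
    obtain ⟨hne, h | h⟩ := (SimpleGraph.fromRel_adj _ p q).1 h
    · exact fromRel_adj_of_rel hne (hr p q h)
    · exact (fromRel_adj_of_rel hne.symm (hr q p h)).symm
  have hy1 : y - 1 ≤ y := by omega
  refine sup_le (sup_le (sup_le (sup_le ?_ ?_) ?_) ?_) ?_
  · exact piece _ fun p q h => levelRel_mono D V W hy1 h
  · refine piece _ ?_
    rintro (u | i) (v | j) h <;> try exact h.elim
    obtain ⟨hu, hv, rfl, hd, hy⟩ := h
    refine ⟨⟨hu, hv, Or.inl ⟨rfl, hd⟩⟩, ?_, hy.le⟩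
    rw [add_unitVec_one_apply_one] at hy
    omega
  · refine piece _ ?_
    rintro (u | i) (v | j) h <;> try exact h.elim
    obtain ⟨hu, hv, rfl, hd, hy⟩ := h
    refine ⟨⟨hu, hv, Or.inr ⟨rfl, hd⟩⟩, hy.le, ?_⟩
    rw [add_unitVec_zero_apply_one]
    exact hy.le
  · refine piece _ ?_
    rintro (u | i) (v | j) h <;> try exact h.elim
    obtain ⟨rfl, hu, hy, hw⟩ := h
    exact ⟨hu, hy.le, hw⟩
  · refine piece _ ?_
    rintro (u | i) (v | j) h <;> try exact h.elim
    obtain ⟨rfl, hu, hy, hw⟩ := h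
    exact ⟨hu, hy.le, hw⟩

/-- Representing stage 4 is representing the level graph at row `y`. [folklore] -/
theorem represents_levelGraph_of_stage4 {β : Type*} (y : ℤ) {ρ : Setoid β} {emb : β → Node}
    (h : Represents ρ (stage4 D V W y) emb) : Represents ρ (levelGraph D V W y) emb := by
  intro a c
  rw [h a c]
  exact ⟨fun h => h.mono (stage4_le_levelGraph D V W y), fun h => h.mono (levelGraph_le_stage4 D V W y)⟩

end Stages

end PolygonWord

end Literature.Probability.LatticeModels

end
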